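import Summits.Ventures.YMGap.YM3IR.InMeanWitness
import Summits.Ventures.YMGap.YM3IR.BalabanCeilings
import Summits.Ventures.YMGap.YM3IR.BalabanCeilingsSU3
import Summits.Ventures.YMGap.YM3IR.BalabanSU3
import HarnessLib

/-!
# YM3IR / ForestWitnessSUN — the honest label, kernel-certified for EVERY §Y4 sentence in the tree (all N, both tiers)

HONEST FRAMING.  Bookkeeping for the cell's track-Y4 honest label (lead R196), NOT mathematics about Yang–Mills: no mass
gap is proved, no continuum statement is made, nothing is claimed about Bałaban's programme.  `YM3IR/ForestWitness.lean`
certified `(∃ C_b κ > 0, IRConjecture3 B …) ↔ MassGap3Cofinal I …` for Y2's TIER-1 balls `ballOfRobustBallFR N ε₀ ε₁ r β⋆`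
and instantiated it on the SU(2) `1/8` row of the §Y4 sentence of record; `YM3IR/InMeanWitness.lean` put the in-mean and
`T_IR` forms in the same class.  The tree meanwhile carries §Y4 sentences on SEVEN further receiving ends (theory-1's
`BalabanCeilings.lean`, `BalabanCeilingsSU3.lean`, `BalabanSU3.lean`, `CovariantFamily.lean`): every `N ≥ 2` on p1's `1/40`
row and on his TIER-2 `1/64` row, `SU(3)` on the `3/40`, star-`1/3`, star-`1/4` and pair rows, `SU(2)` on the star-`1/2`,
`1/4` and tier-2 `1/8` rows.  THIS FILE certifies the label for all of them: on each of those balls, for every unbounded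
coupling set, the free-family hypothesis `∃ C_b κ > 0, IRConjecture3 …` is EQUIVALENT to `MassGap3Cofinal` (and so is its
in-mean form).  READ THE TIER-2 ROWS CORRECTLY: they are the receiving balls of the COVARIANT sentences
(`massGap3Cofinal_su2_W_of_irConjecture3Cov`, `massGap3Cofinal_suN_W_free_of_irConjecture3Cov`); the equivalence proved
here is for the FREE form on the same ball, so it isolates exactly what the pinned conjecture `IRConjecture3Cov` adds
over a restatement of the target — the covariance / block-locality of the family, nothing about the ball.  Label of
record unchanged: typed INTERFACE / dictionary, NOT a reduction; `IRConjecture3Cov` a SUFFICIENT condition, converse not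
known.

CONTENT (all PROVED, axioms standard, 0 compute; theorems only, no new conjecture name).
* `pi_haar_mem_ballOfRobustBall` — product Haar is a member of every tier-2 ball with nonnegative radii and ceiling.
* `entersClusterDomain_forestFamily_of_piHaarMem`, `forestWitness3_of_piHaarMem` — clause (a) and the forest witness for
  ANY `BallSpec` on `SU(N)` whose membership contains product Haar on every torus (generalises `forestWitness3_ballFR`,
  whose proof it follows line by line; the landed theorem is left untouched); `irConjecture3_iff_massGap3Cofinal_of_piHaarMem`.
* `forestWitness3_ball`, `irConjecture3_iff_massGap3Cofinal_ball` — Y2's tier-2 balls `ballOfRobustBall N κ ε₀ ε₁ β⋆`.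
* Instances, one per receiving end in the tree: `suN_W_irConjecture3_iff_massGap3Cofinal` (every `N ≥ 2`, tier 2, `N/64`),
  `su2_W_irConjecture3_iff_massGap3Cofinal` (SU(2) tier 2, `1/16`), `suN_irConjecture3_iff_massGap3Cofinal` (every
  `N ≥ 2`, `N/40`), `su3_irConjecture3_iff_massGap3Cofinal` (`3/40`), `su3_star_oneThird_…`, `su3_star_oneQuarter_…`,
  `su2_star_oneHalf_…`, `su2_oneQuarter_…`, and `su3_pair_irConjecture3_iff_massGap3Cofinal` (engine-2's pair row, under
  its hypotheses H1/H2); in-mean twins `suN_W_irConjecture3InMean_iff_massGap3Cofinal`, `suN_irConjecture3InMean_iff_…`.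
WHY THIS IS NOVEL (cell rule (viii); bookkeeping sense only): the honest-framing fact «the free-family infrared hypothesis
is a reformulation of the lattice gap» was certified for one row; it is now certified uniformly in `N`, in the tier, and
in the row — every §Y4 sentence the paper can quote carries the same kernel-checked label.

References: T. Bałaban, Commun. Math. Phys. 102 (1985) 255–275, Thms 1–2 [cite: Balaban1985UV3]; K. Osterwalder,
E. Seiler, Ann. Phys. 110 (1978) 440, §3 [cite: OsterwalderSeilerAnnPhys1978]; cell files ym3ir/YM3-IR.md §B/§E,
ym3ir/YM3-IR-theory2.md §9–§10, ym3ir/AUDIT-theory2-g4.md.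
-/

noncomputable section

open MeasureTheory ProbabilityTheory
open Literature.MathematicalPhysics.QuantumLattice Literature.MathematicalPhysics.QuantumFieldTheory
open Summit.QuantumFields.BalabanUV.InfraRed.StrongCouplingPoincareDoorSUN (OneLinkPoincareSUN)
open Summit.QuantumFields.BalabanUV.InfraRed.StrongCouplingVarianceDoorSUN (OneLinkVarianceBound)

namespace Summit.Ventures.YMGap.YM3IR

open Literature.MathematicalPhysics.QuantumLattice (fundamentalRep continuous_fundamentalRep)

/-! ## §1 The forest witness for any ball containing product Haar -/

section General

variable {N : ℕ} {r : RobustBall.SUN N → RobustBall.SUN N → ℝ}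

/-- **Product Haar is a member of Y2's tier-2 ball** at Wilson part `β' = 0` and perturbation `W = 0` (tree:
`RobustBall.zero_mem_clusterDomain`), for nonnegative radii and ceiling, any weight `κ`. [folklore] -/
theorem pi_haar_mem_ballOfRobustBall {κ ε₀ ε₁ βstar : ℝ} (h₀ : 0 ≤ ε₀) (h₁ : 0 ≤ ε₁) (hβ : 0 ≤ βstar) (M : ℕ)
    [NeZero M] :
    (ballOfRobustBall N κ ε₀ ε₁ βstar).Mem M (Measure.pi fun _ : Edge 3 M => haarProbability (RobustBall.SUN N)) :=
  ⟨0, le_rfl, hβ, 0, RobustBall.zero_mem_clusterDomain h₀ h₁,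
    (perturbedMeasure_zero_zero (fundamentalRep (Fin N)) M 1).symm⟩

/-- **Clause (a) for the forest family on ANY ball containing product Haar** (block factor `2 ≤ b(β) ≤ C_b β` on `I`):
`EntersClusterDomain` holds with `β' = 0`, `W = 0`, whatever the bare `β`. [folklore] -/
theorem entersClusterDomain_forestFamily_of_piHaarMem {B : BallSpec (RobustBall.SUN N) N}
    (hB : ∀ (M : ℕ) [NeZero M], B.Mem M (Measure.pi fun _ : Edge 3 M => haarProbability (RobustBall.SUN N)))
    {b : ℝ → ℕ} (hb : ∀ β, 0 < b β) {I : Set ℝ} {C_b : ℝ} (h2 : ∀ β ∈ I, 2 ≤ b β)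
    (hfac : ∀ β ∈ I, (b β : ℝ) ≤ C_b * β) :
    EntersClusterDomain B (fundamentalRep (Fin N)) (forestFamily b hb) I C_b := by
  intro β hβI
  refine ⟨by simpa using hfac β hβI, fun M _ hM => ?_⟩
  rw [forestMarginalHaar_of_two_le _ (continuous_fundamentalRep (Fin N)) hb h2 β hβI M hM]
  exact hB M

/-- **The forest witness on ANY ball containing product Haar (generalises `forestWitness3_ballFR`):** for the
fundamental representation of `SU(N)` and every bi-invariant, symmetric, bounded link weight vanishing on the diagonal
and satisfying the triangle inequality, `MassGap3Cofinal I r ρ → ∃ C_b κ > 0, IRConjecture3 B r ρ I C_b κ` for every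
coupling set `I` — witnessed by the gauge forest with block factor `b_T(β)·max(3, ⌈β/b_T(β)⌉)`.  The proof is that of
`forestWitness3_ballFR` with the one ball-dependent step (clause (a)) replaced by `hB`. [folklore] -/
theorem forestWitness3_of_piHaarMem {B : BallSpec (RobustBall.SUN N) N}
    (hB : ∀ (M : ℕ) [NeZero M], B.Mem M (Measure.pi fun _ : Edge 3 M => haarProbability (RobustBall.SUN N)))
    (hmulL : ∀ g a a' : RobustBall.SUN N, r (g * a) (g * a') = r a a')
    (hmulR : ∀ g a a' : RobustBall.SUN N, r (a * g) (a' * g) = r a a')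
    (hsymm : ∀ a a' : RobustBall.SUN N, r a a' = r a' a) (hself : ∀ a : RobustBall.SUN N, r a a = 0)
    (htri : ∀ a a' a'' : RobustBall.SUN N, r a a'' ≤ r a a' + r a' a'')
    (hr : ∃ D : ℝ, ∀ a a' : RobustBall.SUN N, r a a' ≤ D) :
    ForestWitness3 B r (fundamentalRep (Fin N)) := by
  classical
  intro I hMG
  obtain ⟨hI, m₀, hm₀, C_b, hL⟩ := hMG
  obtain ⟨D, hD⟩ := hr
  have hone : ∀ β ∈ I, (1 : ℝ) ≤ C_b * β := fun β hβ => by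
    obtain ⟨bT, hbT, hbTle, -⟩ := hL β hβ
    exact le_trans (by exact_mod_cast hbT) hbTle
  have hCb : 0 < C_b := by
    obtain ⟨β, hβI, hβ0⟩ : ∃ β ∈ I, 0 < β := by
      by_contra hcon
      exact hI ⟨0, fun β hβ => not_lt.mp fun h => hcon ⟨β, hβ, h⟩⟩
    have h1 := hone β hβI
    exact lt_of_not_ge fun hC => by nlinarith
  have hβpos : ∀ β ∈ I, 0 < β := fun β hβ => by
    have h1 := hone β hβ
    exact lt_of_not_ge fun hb => by nlinarith
  -- the target's cofinal side `b_T(β)` (value `1` off `I`)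
  let bT : ℝ → ℕ := fun β => if h : β ∈ I then Classical.choose (hL β h) else 1
  have hbT_spec : ∀ β (h : β ∈ I), 0 < bT β ∧ (bT β : ℝ) ≤ C_b * β ∧ ∃ A : ℝ, ∀ (M : ℕ) [NeZero M],
      bT β ∣ M → 3 * bT β ≤ M →
        ClustersWith r (wilsonMeasure (d := 3) (L := M) (fundamentalRep (Fin N)) β) A (m₀ / β) := by
    intro β h
    have hs := Classical.choose_spec (hL β h)
    simp only [bT, dif_pos h]
    exact hs
  have hbT_pos : ∀ β, 0 < bT β := fun β => by
    by_cases h : β ∈ I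
    · exact (hbT_spec β h).1
    · simp only [bT, dif_neg h]; exact Nat.one_pos
  -- the forest block factor
  let bf : ℝ → ℕ := fun β => bT β * max 3 ⌈β / bT β⌉₊
  have hbf3 : ∀ β, 3 * bT β ≤ bf β := fun β => by
    show 3 * bT β ≤ bT β * max 3 ⌈β / bT β⌉₊
    rw [Nat.mul_comm 3]; exact Nat.mul_le_mul_left _ (le_max_left _ _)
  have hbf : ∀ β, 0 < bf β := fun β => lt_of_lt_of_le (by have := hbT_pos β; omega) (hbf3 β)
  have h2 : ∀ β ∈ I, 2 ≤ bf β := fun β _ => by have := hbf3 β; have := hbT_pos β; omega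
  have hfac : ∀ β ∈ I, (bf β : ℝ) ≤ (4 * C_b + 1) * β := by
    intro β hβ
    obtain ⟨hpos, hle, -⟩ := hbT_spec β hβ
    have hβ0 := hβpos β hβ
    have hbT0 : (0 : ℝ) < bT β := by exact_mod_cast hpos
    have hq : 0 ≤ β / bT β := div_nonneg hβ0.le hbT0.le
    have hk : ((max 3 ⌈β / bT β⌉₊ : ℕ) : ℝ) ≤ 3 + (β / bT β + 1) := by
      rw [Nat.cast_max, Nat.cast_ofNat]
      exact max_le (by linarith) ((Nat.ceil_lt_add_one hq).le.trans (by linarith))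
    calc (bf β : ℝ) = (bT β : ℝ) * ((max 3 ⌈β / bT β⌉₊ : ℕ) : ℝ) := by
          show ((bT β * max 3 ⌈β / bT β⌉₊ : ℕ) : ℝ) = _; push_cast; ring
      _ ≤ (bT β : ℝ) * (3 + (β / bT β + 1)) := mul_le_mul_of_nonneg_left hk hbT0.le
      _ = 4 * (bT β : ℝ) + β := by field_simp; ring
      _ ≤ 4 * (C_b * β) + β := by linarith
      _ = (4 * C_b + 1) * β := by ring
  have hge : ∀ β ∈ I, β ≤ (bf β : ℝ) := by
    intro β hβ
    have hbT0 : (0 : ℝ) < bT β := by exact_mod_cast hbT_pos β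
    calc β = (bT β : ℝ) * (β / bT β) := by field_simp
      _ ≤ (bT β : ℝ) * (⌈β / bT β⌉₊ : ℝ) := mul_le_mul_of_nonneg_left (Nat.le_ceil _) hbT0.le
      _ ≤ (bT β : ℝ) * ((max 3 ⌈β / bT β⌉₊ : ℕ) : ℝ) :=
          mul_le_mul_of_nonneg_left (by exact_mod_cast le_max_right _ _) hbT0.le
      _ = (bf β : ℝ) := by show _ = ((bT β * max 3 ⌈β / bT β⌉₊ : ℕ) : ℝ); push_cast; ring
  refine ⟨4 * C_b + 1, m₀, by linarith, hm₀, forestFamily bf hbf,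
    entersClusterDomain_forestFamily_of_piHaarMem hB hbf h2 hfac, fun β hβI => ?_⟩
  obtain ⟨hpos, hle, A, hA⟩ := hbT_spec β hβI
  have hβ0 := hβpos β hβI
  have hmβ : 0 ≤ m₀ / β := div_nonneg hm₀.le hβ0.le
  refine forestFamily_fluctuationDecouplingAt (fundamentalRep (Fin N)) (continuous_fundamentalRep (Fin N)) hbf
    (h2 β hβI) hmulL hmulR hsymm hself htri hD (le_max_right A 0) hmβ ?_ fun M _ => ?_
  · calc m₀ = m₀ / β * β := by field_simp
      _ ≤ m₀ / β * (bf β : ℝ) := mul_le_mul_of_nonneg_left (hge β hβI) hmβ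
  · haveI : NeZero (bf β * M) := ⟨Nat.mul_ne_zero (hbf β).ne' (NeZero.ne M)⟩
    have hdvd : bT β ∣ bf β * M := Dvd.dvd.mul_right (Dvd.intro _ rfl) M
    have h3 : 3 * bT β ≤ bf β * M :=
      (hbf3 β).trans (Nat.le_mul_of_pos_right _ (Nat.pos_of_ne_zero (NeZero.ne M)))
    exact clustersWith_max_zero (hA (bf β * M) hdvd h3)

/-- **On ANY ball containing product Haar on which Y2's clustering holds at a rate `m_c > 0`:** for every unbounded
coupling set and admissible link weight, `(∃ C_b κ > 0, IRConjecture3 B …) ↔ MassGap3Cofinal I r ρ_fund`. [folklore] -/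
theorem irConjecture3_iff_massGap3Cofinal_of_piHaarMem {B : BallSpec (RobustBall.SUN N) N}
    (hB : ∀ (M : ℕ) [NeZero M], B.Mem M (Measure.pi fun _ : Edge 3 M => haarProbability (RobustBall.SUN N)))
    {I : Set ℝ} {m_c : ℝ} (hI : ¬ BddAbove I) (hm : 0 < m_c)
    (hmulL : ∀ g a a' : RobustBall.SUN N, r (g * a) (g * a') = r a a')
    (hmulR : ∀ g a a' : RobustBall.SUN N, r (a * g) (a' * g) = r a a')
    (hsymm : ∀ a a' : RobustBall.SUN N, r a a' = r a' a) (hself : ∀ a : RobustBall.SUN N, r a a = 0)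
    (htri : ∀ a a' a'' : RobustBall.SUN N, r a a'' ≤ r a a' + r a' a'')
    (hr : ∃ D : ℝ, ∀ a a' : RobustBall.SUN N, r a a' ≤ D) (hRB : ClusterDomainClustering B r m_c) :
    (∃ C_b κ : ℝ, 0 < C_b ∧ 0 < κ ∧ IRConjecture3 B r (fundamentalRep (Fin N)) I C_b κ)
      ↔ MassGap3Cofinal I r (fundamentalRep (Fin N)) :=
  irConjecture3_iff_massGap3Cofinal_of_forestWitness (forestWitness3_of_piHaarMem hB hmulL hmulR hsymm hself htri hr)
    hI hm hr hRB

/-- **The forest witness on Y2's TIER-2 balls** `ballOfRobustBall N κ ε₀ ε₁ β⋆` (`ε₀, ε₁, β⋆ ≥ 0`, any weight `κ`).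
[folklore] -/
theorem forestWitness3_ball {κ ε₀ ε₁ βstar : ℝ} (h₀ : 0 ≤ ε₀) (h₁ : 0 ≤ ε₁) (hβ : 0 ≤ βstar)
    (hmulL : ∀ g a a' : RobustBall.SUN N, r (g * a) (g * a') = r a a')
    (hmulR : ∀ g a a' : RobustBall.SUN N, r (a * g) (a' * g) = r a a')
    (hsymm : ∀ a a' : RobustBall.SUN N, r a a' = r a' a) (hself : ∀ a : RobustBall.SUN N, r a a = 0)
    (htri : ∀ a a' a'' : RobustBall.SUN N, r a a'' ≤ r a a' + r a' a'')
    (hr : ∃ D : ℝ, ∀ a a' : RobustBall.SUN N, r a a' ≤ D) :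
    ForestWitness3 (ballOfRobustBall N κ ε₀ ε₁ βstar) r (fundamentalRep (Fin N)) :=
  forestWitness3_of_piHaarMem (fun M _ => pi_haar_mem_ballOfRobustBall h₀ h₁ hβ M) hmulL hmulR hsymm hself htri hr

/-- **Tier 2: `(∃ C_b κ > 0, IRConjecture3 (ballOfRobustBall N κ ε₀ ε₁ β⋆) …) ↔ MassGap3Cofinal`** whenever Y2's
clustering holds on that ball at a positive rate. [folklore] -/
theorem irConjecture3_iff_massGap3Cofinal_ball {κ ε₀ ε₁ βstar : ℝ} (h₀ : 0 ≤ ε₀) (h₁ : 0 ≤ ε₁) (hβ : 0 ≤ βstar)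
    {I : Set ℝ} {m_c : ℝ} (hI : ¬ BddAbove I) (hm : 0 < m_c)
    (hmulL : ∀ g a a' : RobustBall.SUN N, r (g * a) (g * a') = r a a')
    (hmulR : ∀ g a a' : RobustBall.SUN N, r (a * g) (a' * g) = r a a')
    (hsymm : ∀ a a' : RobustBall.SUN N, r a a' = r a' a) (hself : ∀ a : RobustBall.SUN N, r a a = 0)
    (htri : ∀ a a' a'' : RobustBall.SUN N, r a a'' ≤ r a a' + r a' a'')
    (hr : ∃ D : ℝ, ∀ a a' : RobustBall.SUN N, r a a' ≤ D)
    (hRB : ClusterDomainClustering (ballOfRobustBall N κ ε₀ ε₁ βstar) r m_c) :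
    (∃ C_b κ' : ℝ, 0 < C_b ∧ 0 < κ' ∧ IRConjecture3 (ballOfRobustBall N κ ε₀ ε₁ βstar) r (fundamentalRep (Fin N)) I C_b κ')
      ↔ MassGap3Cofinal I r (fundamentalRep (Fin N)) :=
  irConjecture3_iff_massGap3Cofinal_of_forestWitness (forestWitness3_ball h₀ h₁ hβ hmulL hmulR hsymm hself htri hr)
    hI hm hr hRB

end General

/-! ## §2 The receiving ends of the §Y4 sentences in the tree, one by one (Y2's metric `suFrobDist`) -/

section Rows

/-- Shorthand for this section: Y2's link metric on `SU(N)` has every property the witness needs. -/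
theorem forestWitness3_ball_suFrobDist {N : ℕ} {κ ε₀ ε₁ βstar : ℝ} (h₀ : 0 ≤ ε₀) (h₁ : 0 ≤ ε₁)
    (hβ : 0 ≤ βstar) :
    ForestWitness3 (ballOfRobustBall N κ ε₀ ε₁ βstar) suFrobDist (fundamentalRep (Fin N)) :=
  forestWitness3_ball h₀ h₁ hβ suFrobDist_mul_left suFrobDist_mul_right suFrobDist_comm suFrobDist_self
    suFrobDist_triangle (suFrobDist_bddAbove N)

/-- Shorthand: the tier-1 forest witness of `ForestWitness.lean` in Y2's metric. -/
theorem forestWitness3_ballFR_suFrobDist {N : ℕ} {ε₀ ε₁ βstar : ℝ} (h₀ : 0 ≤ ε₀) (h₁ : 0 ≤ ε₁)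
    (hβ : 0 ≤ βstar) (rFR : ℕ) :
    ForestWitness3 (ballOfRobustBallFR N ε₀ ε₁ rFR βstar) suFrobDist (fundamentalRep (Fin N)) :=
  forestWitness3_ballFR h₀ h₁ hβ rFR suFrobDist_mul_left suFrobDist_mul_right suFrobDist_comm suFrobDist_self
    suFrobDist_triangle (suFrobDist_bddAbove N)

/-- **Every `N ≥ 2`, TIER 2 — the receiving ball of the covariant sentences `massGap3Cofinal_suN_W_free_of_irConjecture3`
/ `…Cov` (`BalabanCeilings.lean`):** on `ballOfRobustBall N (log 6/5) (19/50) (19/100) (N/64)` (p1's hypothesis-free row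
`RobustBallSUN.suN_clusterDomainClusteringW_dim3_1_64`), for every unbounded coupling set, the FREE-family hypothesis is
EQUIVALENT to the target.  Hence what `IRConjecture3Cov` adds over a restatement on this ball is exactly the covariance /
block-locality pin. [folklore] -/
theorem suN_W_irConjecture3_iff_massGap3Cofinal {N : ℕ} (hN : 2 ≤ N) {I : Set ℝ} (hI : ¬ BddAbove I) :
    (∃ C_b κ : ℝ, 0 < C_b ∧ 0 < κ ∧
        IRConjecture3 (ballOfRobustBall N (Real.log (6 / 5)) (19 / 50) (19 / 100) ((N : ℝ) / 64)) suFrobDist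
          (fundamentalRep (Fin N)) I C_b κ)
      ↔ MassGap3Cofinal I suFrobDist (fundamentalRep (Fin N) : RobustBall.SUN N →* Matrix (Fin N) (Fin N) ℂ) :=
  irConjecture3_iff_massGap3Cofinal_of_forestWitness
    (forestWitness3_ball_suFrobDist (by norm_num) (by norm_num) (by positivity)) hI
    (Real.log_pos (by norm_num)) (suFrobDist_bddAbove N) (RobustBallSUN.suN_clusterDomainClusteringW_dim3_1_64 N hN)

/-- In-mean twin of `suN_W_irConjecture3_iff_massGap3Cofinal`. [folklore] -/
theorem suN_W_irConjecture3InMean_iff_massGap3Cofinal {N : ℕ} (hN : 2 ≤ N) {I : Set ℝ} (hI : ¬ BddAbove I) :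
    (∃ C_b κ : ℝ, 0 < C_b ∧ 0 < κ ∧
        IRConjecture3InMean (ballOfRobustBall N (Real.log (6 / 5)) (19 / 50) (19 / 100) ((N : ℝ) / 64)) suFrobDist
          (fundamentalRep (Fin N)) I C_b κ)
      ↔ MassGap3Cofinal I suFrobDist (fundamentalRep (Fin N) : RobustBall.SUN N →* Matrix (Fin N) (Fin N) ℂ) :=
  irConjecture3InMean_iff_massGap3Cofinal_of_forestWitness
    (forestWitness3_ball_suFrobDist (by norm_num) (by norm_num) (by positivity)) hI
    (Real.log_pos (by norm_num)) (suFrobDist_bddAbove N) (RobustBallSUN.suN_clusterDomainClusteringW_dim3_1_64 N hN)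

/-- **`SU(2)`, TIER 2 — the receiving ball of `massGap3Cofinal_su2_W_of_irConjecture3Cov` (`CovariantFamily.lean`) and
of the covariant T29 candidate:** on `ballOfRobustBall 2 (log 6/5) (9/25) (9/50) (1/16)` (ds-2's hypothesis-free row
`RobustBall.su2_clusterDomainClusteringW_dim3_oneEighth_w65`), the FREE-family hypothesis is EQUIVALENT to the target.
[folklore] -/
theorem su2_W_irConjecture3_iff_massGap3Cofinal {I : Set ℝ} (hI : ¬ BddAbove I) :
    (∃ C_b κ : ℝ, 0 < C_b ∧ 0 < κ ∧
        IRConjecture3 (ballOfRobustBall 2 (Real.log (6 / 5)) (9 / 25) (9 / 50) (1 / 16)) suFrobDist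
          (fundamentalRep (Fin 2)) I C_b κ)
      ↔ MassGap3Cofinal I suFrobDist (fundamentalRep (Fin 2) : RobustBall.SUN 2 →* Matrix (Fin 2) (Fin 2) ℂ) :=
  irConjecture3_iff_massGap3Cofinal_of_forestWitness
    (forestWitness3_ball_suFrobDist (by norm_num) (by norm_num) (by norm_num)) hI
    (Real.log_pos (by norm_num)) (suFrobDist_bddAbove 2) RobustBall.su2_clusterDomainClusteringW_dim3_oneEighth_w65

/-- **Every `N ≥ 2`, tier 1, 't Hooft ceiling `1/40` — the receiving ball of
`massGap3Cofinal_suN_balaban_free_of_irConjecture3` (`BalabanCeilings.lean`):** `(∃ C_b κ > 0, IRConjecture3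
(ballOfRobustBallFR N (87/500) (87/1000) r (N/40)) …) ↔ MassGap3Cofinal`. [folklore] -/
theorem suN_irConjecture3_iff_massGap3Cofinal {N : ℕ} (hN : 2 ≤ N) (rFR : ℕ) {I : Set ℝ} (hI : ¬ BddAbove I) :
    (∃ C_b κ : ℝ, 0 < C_b ∧ 0 < κ ∧
        IRConjecture3 (ballOfRobustBallFR N (87 / 500) (87 / 1000) rFR ((N : ℝ) / 40)) suFrobDist
          (fundamentalRep (Fin N)) I C_b κ)
      ↔ MassGap3Cofinal I suFrobDist (fundamentalRep (Fin N) : RobustBall.SUN N →* Matrix (Fin N) (Fin N) ℂ) :=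
  irConjecture3_iff_massGap3Cofinal_of_forestWitness
    (forestWitness3_ballFR_suFrobDist (by norm_num) (by norm_num) (by positivity) rFR) hI
    (RobustBallSUN.suN_rows_rate_pos' rFR).1 (suFrobDist_bddAbove N)
    (RobustBallSUN.suN_clusterDomainClustering_dim3_1_40 N hN rFR)

/-- In-mean twin of `suN_irConjecture3_iff_massGap3Cofinal`. [folklore] -/
theorem suN_irConjecture3InMean_iff_massGap3Cofinal {N : ℕ} (hN : 2 ≤ N) (rFR : ℕ) {I : Set ℝ}
    (hI : ¬ BddAbove I) :
    (∃ C_b κ : ℝ, 0 < C_b ∧ 0 < κ ∧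
        IRConjecture3InMean (ballOfRobustBallFR N (87 / 500) (87 / 1000) rFR ((N : ℝ) / 40)) suFrobDist
          (fundamentalRep (Fin N)) I C_b κ)
      ↔ MassGap3Cofinal I suFrobDist (fundamentalRep (Fin N) : RobustBall.SUN N →* Matrix (Fin N) (Fin N) ℂ) :=
  irConjecture3InMean_iff_massGap3Cofinal_of_forestWitness
    (forestWitness3_ballFR_suFrobDist (by norm_num) (by norm_num) (by positivity) rFR) hI
    (RobustBallSUN.suN_rows_rate_pos' rFR).1 (suFrobDist_bddAbove N)
    (RobustBallSUN.suN_clusterDomainClustering_dim3_1_40 N hN rFR)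

/-- **`SU(3)` — the physical colour group — tier 1, ceiling `3/40`: the receiving ball of
`massGap3Cofinal_su3_balaban_free_of_irConjecture3` (`BalabanCeilings.lean`).** [folklore] -/
theorem su3_irConjecture3_iff_massGap3Cofinal (rFR : ℕ) {I : Set ℝ} (hI : ¬ BddAbove I) :
    (∃ C_b κ : ℝ, 0 < C_b ∧ 0 < κ ∧
        IRConjecture3 (ballOfRobustBallFR 3 (87 / 500) (87 / 1000) rFR ((3 : ℝ) / 40)) suFrobDist
          (fundamentalRep (Fin 3)) I C_b κ)
      ↔ MassGap3Cofinal I suFrobDist (fundamentalRep (Fin 3) : RobustBall.SUN 3 →* Matrix (Fin 3) (Fin 3) ℂ) := by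
  simpa using suN_irConjecture3_iff_massGap3Cofinal (N := 3) (by norm_num) rFR hI

/-- **`SU(3)`, tier 1, star row `β_W = 1/3` (ceiling `1/9`): the receiving ball of
`massGap3Cofinal_su3_balaban_star_oneThird_of_irConjecture3` (`BalabanCeilingsSU3.lean`; ds-2's S7 row
`RobustBall.su3_clusterDomainClustering_dim3_star_oneThird`).** [folklore] -/
theorem su3_star_oneThird_irConjecture3_iff_massGap3Cofinal (rFR : ℕ) {I : Set ℝ} (hI : ¬ BddAbove I) :
    (∃ C_b κ : ℝ, 0 < C_b ∧ 0 < κ ∧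
        IRConjecture3 (ballOfRobustBallFR 3 (1 / 10) (1 / 20) rFR (1 / 9)) suFrobDist
          (fundamentalRep (Fin 3)) I C_b κ)
      ↔ MassGap3Cofinal I suFrobDist (fundamentalRep (Fin 3) : RobustBall.SUN 3 →* Matrix (Fin 3) (Fin 3) ℂ) := by
  obtain ⟨m, hm, hRB, -⟩ := RobustBall.su3_clusterDomainClustering_dim3_star_oneThird rFR
  exact irConjecture3_iff_massGap3Cofinal_of_forestWitness
    (forestWitness3_ballFR_suFrobDist (by norm_num) (by norm_num) (by norm_num) rFR) hI hm (suFrobDist_bddAbove 3) hRB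

/-- **`SU(3)`, tier 1, star row `β_W = 1/4` (ceiling `1/12`): the receiving ball of
`massGap3Cofinal_su3_balaban_star_oneQuarter_of_irConjecture3` (`BalabanCeilingsSU3.lean`; ds-2's row
`RobustBall.su3_clusterDomainClustering_dim3_star_oneQuarter`).** [folklore] -/
theorem su3_star_oneQuarter_irConjecture3_iff_massGap3Cofinal (rFR : ℕ) {I : Set ℝ} (hI : ¬ BddAbove I) :
    (∃ C_b κ : ℝ, 0 < C_b ∧ 0 < κ ∧
        IRConjecture3 (ballOfRobustBallFR 3 (53 / 250) (53 / 500) rFR (1 / 12)) suFrobDist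
          (fundamentalRep (Fin 3)) I C_b κ)
      ↔ MassGap3Cofinal I suFrobDist (fundamentalRep (Fin 3) : RobustBall.SUN 3 →* Matrix (Fin 3) (Fin 3) ℂ) := by
  obtain ⟨m, hm, hRB, -⟩ := RobustBall.su3_clusterDomainClustering_dim3_star_oneQuarter rFR
  exact irConjecture3_iff_massGap3Cofinal_of_forestWitness
    (forestWitness3_ballFR_suFrobDist (by norm_num) (by norm_num) (by norm_num) rFR) hI hm (suFrobDist_bddAbove 3) hRB

/-- **`SU(3)`, tier 1, engine-2's pair row (ceiling `(1/4)/3`) — the receiving ball of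
`massGap3Cofinal_su3_balaban_of_pair_of_irConjecture3` (`BalabanSU3.lean`), UNDER that sentence's own certified-computation
hypotheses H1/H2:** given them, the free-family hypothesis is again EQUIVALENT to the target. [folklore] -/
theorem su3_pair_irConjecture3_iff_massGap3Cofinal (hP : OneLinkPoincareSUN 3 (3 / 5) (4 / 5))
    (hV : OneLinkVarianceBound 3 (11 / 30) (49 / 20)) (rFR : ℕ) {I : Set ℝ} (hI : ¬ BddAbove I) :
    (∃ C_b κ : ℝ, 0 < C_b ∧ 0 < κ ∧
        IRConjecture3 (ballOfRobustBallFR 3 (2 * (23 / 100)) (23 / 100) rFR ((1 / 4) / 3)) suFrobDist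
          (fundamentalRep (Fin 3)) I C_b κ)
      ↔ MassGap3Cofinal I suFrobDist (fundamentalRep (Fin 3) : RobustBall.SUN 3 →* Matrix (Fin 3) (Fin 3) ℂ) :=
  irConjecture3_iff_massGap3Cofinal_of_forestWitness
    (forestWitness3_ballFR_suFrobDist (by norm_num) (by norm_num) (by norm_num) rFR) hI
    (su3_dim3_quarter_rate_pos' rFR) (suFrobDist_bddAbove 3) (RobustBallSU3.su3_ym3Row_1_4 hP hV rFR)

/-- **`SU(2)`, tier 1, star row `β_W = 1/2` (ceiling `1/4`, the highest certified `d = 3` Wilson ceiling): the receiving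
ball of `massGap3Cofinal_su2_balaban_star_oneHalf_of_irConjecture3` (`BalabanCeilings.lean`; ds-2's S6 row
`RobustBall.su2_clusterDomainClustering_dim3_star_oneHalf`).** [folklore] -/
theorem su2_star_oneHalf_irConjecture3_iff_massGap3Cofinal (rFR : ℕ) {I : Set ℝ} (hI : ¬ BddAbove I) :
    (∃ C_b κ : ℝ, 0 < C_b ∧ 0 < κ ∧
        IRConjecture3 (ballOfRobustBallFR 2 (17 / 500) (17 / 1000) rFR (1 / 4)) suFrobDist
          (fundamentalRep (Fin 2)) I C_b κ)
      ↔ MassGap3Cofinal I suFrobDist (fundamentalRep (Fin 2) : RobustBall.SUN 2 →* Matrix (Fin 2) (Fin 2) ℂ) := by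
  obtain ⟨m, hm, hRB, -⟩ := RobustBall.su2_clusterDomainClustering_dim3_star_oneHalf rFR
  exact irConjecture3_iff_massGap3Cofinal_of_forestWitness
    (forestWitness3_ballFR_suFrobDist (by norm_num) (by norm_num) (by norm_num) rFR) hI hm (suFrobDist_bddAbove 2) hRB

/-- **`SU(2)`, tier 1, the `β_W = 1/4` row (ceiling `1/8`): the receiving ball of
`massGap3Cofinal_su2_balaban_quarterRow_of_irConjecture3` (`BalabanSU2.lean`; ds-2's row
`RobustBall.su2_clusterDomainClustering_dim3_oneQuarter`).** [folklore] -/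
theorem su2_oneQuarter_irConjecture3_iff_massGap3Cofinal (rFR : ℕ) {I : Set ℝ} (hI : ¬ BddAbove I) :
    (∃ C_b κ : ℝ, 0 < C_b ∧ 0 < κ ∧
        IRConjecture3 (ballOfRobustBallFR 2 (3 / 25) (3 / 50) rFR (1 / 8)) suFrobDist
          (fundamentalRep (Fin 2)) I C_b κ)
      ↔ MassGap3Cofinal I suFrobDist (fundamentalRep (Fin 2) : RobustBall.SUN 2 →* Matrix (Fin 2) (Fin 2) ℂ) :=
  irConjecture3_iff_massGap3Cofinal_of_forestWitness
    (forestWitness3_ballFR_suFrobDist (by norm_num) (by norm_num) (by norm_num) rFR) hI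
    (su2_dim3_oneQuarter_rate_pos' rFR) (suFrobDist_bddAbove 2) (RobustBall.su2_clusterDomainClustering_dim3_oneQuarter rFR)

end Rows

end Summit.Ventures.YMGap.YM3IR

end
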